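import Summits.QuantumFields.QCD.Theorems.HeatSlicedQuarksRobustYangMillsHandoverStubFlavourChainSliceDictionary
import Summits.QuantumFields.QCD.Theorems.HeatSlicedQuarksRobustYangMillsHandoverStubChainBlockInsertionAlgebra
import Summits.QuantumFields.QCD.Theorems.QuarksAsStableActionStableActionBridgeChainBlockSmit
import HarnessLib

/-!
# Stub `stub_flavourChain_dressedCore` of line `pin-the-infimum`
(crux `RobustYangMillsHandover`, 8892)

E2 (fermionic insertions in Lüscher's transfer form), layer W2-3b: **the `N_f`-flavour dressed core
is Smit's `V M_F V⁻¹`, its explicit inverse is `V M_F⁻¹ V⁻¹`, and the chain-block prefactor is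
`det A(U_t)²`.**

Lüscher's reduction of the `N_f`-flavour `r = 1` Wilson–Dirac matrix with an equal-time source
(landed γ0 layer `stub_diracMatrix_source_timeSlice`) is a projector chain on the slice index
`(flavour × (ℤ/L)³) × colour × spin` with explicit `Matrix.of` lifts `P± = ½(1 ± γ₄)`, the inverse
temporal transporter `W′_s = ρ(U((s,y),0)⁻¹)`, the flavour-block-diagonal slice operator `A_t` and
the spin lift `B̂ = reindex e e (A(U_t) ⊗ 1₄)` of its spin-blind block,
`e = (Equiv.prodAssoc flavour site (colour × spin)).symm`, `U_t : e ↦ U((t, e.1), e.2.succ)`.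
Per slice it produces the dressed one-step core
`M′ = (1 + P⁺ C P⁻)(B̂ P⁺ + B̂⁻¹ P⁻)(1 − P⁻ C P⁺)`, `C = A − B̂`, with explicit inverse
`M′ᵢ = (1 + P⁻ C P⁺)(B̂⁻¹ P⁺ + B̂ P⁻)(1 − P⁺ C P⁻)`, and the prefactor `det E_t`,
`E_t = A P⁻ − P⁺ W′_{t−1}`.  This file proves, verbatim as registered:

1. `M′ = reindex e e (V M_F(U_t) V⁻¹)` with Smit's one-particle fermionic transfer matrix
   `M_F = fermionSliceMatrix U_t mq` (*Introduction to Quantum Fields on a Lattice*, §6.5 (6.91))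
   and the unitary spin rotation `V = 1 ⊗ γ₄γ₅`, `V⁻¹ = 1 ⊗ γ₅γ₄` — the `N_f`-flavour version of
   the landed one-flavour `dressedCore_timeSlice_eq`, with the re-association `e` in place of
   `Fin 1 × X ≃ X`: dictionary (`stub_flavourChain_slice_dictionary`), transport along the algebra
   isomorphism `reindex e e` (`DressedCoreDict.reindex_dressedCore`), and the pure `sliceKron`
   identity `DressedCoreDict.dressedCore_sliceKron_eq`;
2. `M′ᵢ = reindex e e (V M_F⁻¹ V⁻¹)`: `M′ M′ᵢ = 1` is the ring identity
   `StubChainBlockInsertionAlgebra.core_mul_coreInv` (`B̂` invertible for masses `> −1`), so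
   `M′ᵢ = M′⁻¹ = reindex e e ((V M_F V⁻¹)⁻¹)` and `(V M_F V⁻¹)⁻¹ = V M_F⁻¹ V⁻¹` (`V V⁻¹ = 1`);
3. `det E_t = det A(U_t)²`: at the flavoured index the chain block factorises as
   `E_t = (B̂ P⁻ − P⁺ W′)(1 − W P⁺ C P⁻)` (`ChainBlockDet.chainBlock_eq_mul`), the second factor is
   unipotent, and the first is the Kronecker matrix `(−w′) ⊗ P⁺ + B ⊗ P⁻` on
   `((flavour × site) × colour) × spin` with `det = det(w′)² det(B)²`
   (`ChainBlockDet.det_spinDiag_projMinus_sub_projPlus_colour`), `det w′ = 1` (`SU(3)` blocks) and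
   `B = reindex (A(U_t))`;
4. `det E_t` is a unit for masses `> −1` (`sliceMassHop_posDef`).

Pure theorem file (no definitions); Mathlib plus the tree's `StableActionBridge.Sketch` bricks and
the landed W2-3a / β1 stubs.

References: J. Smit, *Introduction to Quantum Fields on a Lattice* (CUP 2002/2023), §6.5
(6.74)–(6.77), (6.91); M. Lüscher, Comm. Math. Phys. 54 (1977) 283–292.
-/

namespace Summit.QuantumFields.QCD.Cruxes.RobustYangMillsHandover.PinTheInfimum

open Literature.MathematicalPhysics.QuantumLattice Literature.MathematicalPhysics.QuantumFieldTheory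
open Literature.Probability.LatticeModels (TorusSite)
open Summit.QuantumFields.QCD.Cruxes.StableActionBridge.Sketch
open scoped ComplexOrder Kronecker

namespace StubFlavourChainDressedCore

/-! ### Colour blocks of `SU(3)` links on a general site index -/

/-- The site-block-diagonal colour matrix of inverse `SU(3)` link variables (defining
representation) on `X × colour` has determinant one. [folklore] -/
theorem det_invLinkBlock_eq_one {X : Type*} [Fintype X] [DecidableEq X]
    (g : X → Matrix.specialUnitaryGroup (Fin 3) ℂ) :
    (Matrix.of fun p q : X × Fin 3 =>
        if p.1 = q.1 then fundamentalRep (Fin 3) (g p.1)⁻¹ p.2 q.2 else 0).det = 1 := by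
  -- adapted from `ChainBlockSmit.det_invLinkBlock_eq_one` (site index generalised)
  rw [APChainBlockPos.det_of_siteBlockDiag fun x : X => fundamentalRep (Fin 3) (g x)⁻¹]
  refine Finset.prod_eq_one fun x _ => ?_
  rw [fundamentalRep_apply]
  exact (Matrix.mem_specialUnitaryGroup_iff.1 ((g x)⁻¹).2).2

/-- `w′ w = 1` for the site-block-diagonal colour matrices of the inverse links `ρ(g x)⁻¹` and of
the links `ρ(g x)` (`ρ(g⁻¹) ρ(g) = ρ(1) = 1`). [folklore] -/
theorem invLinkBlock_mul_linkBlock {X : Type*} [Fintype X] [DecidableEq X]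
    (g : X → Matrix.specialUnitaryGroup (Fin 3) ℂ) :
    (Matrix.of fun p q : X × Fin 3 =>
        if p.1 = q.1 then fundamentalRep (Fin 3) (g p.1)⁻¹ p.2 q.2 else 0) *
      (Matrix.of fun p q : X × Fin 3 =>
        if p.1 = q.1 then fundamentalRep (Fin 3) (g p.1) p.2 q.2 else 0) = 1 :=
  SliceSpin.of_colour_mul_of_colour_eq_one (fun x => fundamentalRep (Fin 3) (g x)⁻¹)
    (fun x => fundamentalRep (Fin 3) (g x)) fun x => by rw [← map_mul, inv_mul_cancel, map_one]

/-! ### The chain-block determinant in Kronecker form on `(X × Y) × spin` -/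

variable {X Y : Type*} [Fintype X] [DecidableEq X] [Fintype Y] [DecidableEq Y]

/-- Mixed transported Kronecker factors commute: `(M ⊗ 1)(1 ⊗ S) = (1 ⊗ S)(M ⊗ 1)`. [folklore] -/
theorem kronecker_one_comm (M : Matrix (X × Y) (X × Y) ℂ) (S : Matrix (Fin 4) (Fin 4) ℂ) :
    Matrix.reindexAlgEquiv ℂ ℂ (Equiv.prodAssoc X Y (Fin 4)) (M ⊗ₖ (1 : Matrix (Fin 4) (Fin 4) ℂ)) *
        Matrix.reindexAlgEquiv ℂ ℂ (Equiv.prodAssoc X Y (Fin 4))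
          ((1 : Matrix (X × Y) (X × Y) ℂ) ⊗ₖ S) =
      Matrix.reindexAlgEquiv ℂ ℂ (Equiv.prodAssoc X Y (Fin 4))
          ((1 : Matrix (X × Y) (X × Y) ℂ) ⊗ₖ S) *
        Matrix.reindexAlgEquiv ℂ ℂ (Equiv.prodAssoc X Y (Fin 4))
          (M ⊗ₖ (1 : Matrix (Fin 4) (Fin 4) ℂ)) := by
  -- adapted from `SliceSpin.kronecker_claims` (the `comm` step)
  rw [← map_mul, ← map_mul, ← Matrix.mul_kronecker_mul, ← Matrix.mul_kronecker_mul,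
    Matrix.one_mul, Matrix.mul_one, Matrix.one_mul, Matrix.mul_one]

/-- **The chain-block determinant in Kronecker form.**  On `X × Y × spin` let `P± = 1 ⊗ ½(1 ± γ₄)`,
`B̂ = B ⊗ 1`, `W = w ⊗ 1`, `W′ = w′ ⊗ 1` (transported along `Equiv.prodAssoc`) with `w′ w = 1`,
`det w′ = 1`, and let `A` be any slice operator with `P⁻ A P⁻ = B̂ P⁻`.  Then
`det (A P⁻ − P⁺ W′) = det(B)²`: `A P⁻ − P⁺ W′ = (B̂ P⁻ − P⁺ W′)(1 − W P⁺ (A − B̂) P⁻)`, the second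
factor is unipotent and the first is `(−w′) ⊗ P⁺ + B ⊗ P⁻`. [cite: Luscher1977, pp. 283–292] -/
theorem det_chainBlock_of_kronecker (A : Matrix (X × Y × Fin 4) (X × Y × Fin 4) ℂ)
    (B w w' : Matrix (X × Y) (X × Y) ℂ) (hw : w' * w = 1) (hw' : w'.det = 1)
    (hA : Matrix.reindexAlgEquiv ℂ ℂ (Equiv.prodAssoc X Y (Fin 4))
            ((1 : Matrix (X × Y) (X × Y) ℂ) ⊗ₖ ((1 / 2 : ℂ) • (1 - euclideanGamma 0))) * A *
          Matrix.reindexAlgEquiv ℂ ℂ (Equiv.prodAssoc X Y (Fin 4))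
            ((1 : Matrix (X × Y) (X × Y) ℂ) ⊗ₖ ((1 / 2 : ℂ) • (1 - euclideanGamma 0))) =
        Matrix.reindexAlgEquiv ℂ ℂ (Equiv.prodAssoc X Y (Fin 4))
            (B ⊗ₖ (1 : Matrix (Fin 4) (Fin 4) ℂ)) *
          Matrix.reindexAlgEquiv ℂ ℂ (Equiv.prodAssoc X Y (Fin 4))
            ((1 : Matrix (X × Y) (X × Y) ℂ) ⊗ₖ ((1 / 2 : ℂ) • (1 - euclideanGamma 0)))) :
    (A * Matrix.reindexAlgEquiv ℂ ℂ (Equiv.prodAssoc X Y (Fin 4))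
            ((1 : Matrix (X × Y) (X × Y) ℂ) ⊗ₖ ((1 / 2 : ℂ) • (1 - euclideanGamma 0))) -
        Matrix.reindexAlgEquiv ℂ ℂ (Equiv.prodAssoc X Y (Fin 4))
            ((1 : Matrix (X × Y) (X × Y) ℂ) ⊗ₖ ((1 / 2 : ℂ) • (1 + euclideanGamma 0))) *
          Matrix.reindexAlgEquiv ℂ ℂ (Equiv.prodAssoc X Y (Fin 4))
            (w' ⊗ₖ (1 : Matrix (Fin 4) (Fin 4) ℂ))).det =
      B.det ^ 2 := by
  -- adapted from `det_wilson_chainBlock` (ChainBlockDet.lean), site index generalised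
  have h1 : Matrix.reindexAlgEquiv ℂ ℂ (Equiv.prodAssoc X Y (Fin 4))
        ((1 : Matrix (X × Y) (X × Y) ℂ) ⊗ₖ ((1 / 2 : ℂ) • (1 + euclideanGamma 0))) +
      Matrix.reindexAlgEquiv ℂ ℂ (Equiv.prodAssoc X Y (Fin 4))
        ((1 : Matrix (X × Y) (X × Y) ℂ) ⊗ₖ ((1 / 2 : ℂ) • (1 - euclideanGamma 0))) = 1 := by
    rw [← map_add, ← Matrix.kronecker_add, projPlus_add_projMinus, Matrix.one_kronecker_one,
      map_one]
  have hPQ : Matrix.reindexAlgEquiv ℂ ℂ (Equiv.prodAssoc X Y (Fin 4))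
        ((1 : Matrix (X × Y) (X × Y) ℂ) ⊗ₖ ((1 / 2 : ℂ) • (1 + euclideanGamma 0))) *
      Matrix.reindexAlgEquiv ℂ ℂ (Equiv.prodAssoc X Y (Fin 4))
        ((1 : Matrix (X × Y) (X × Y) ℂ) ⊗ₖ ((1 / 2 : ℂ) • (1 - euclideanGamma 0))) = 0 := by
    rw [← map_mul, ← Matrix.mul_kronecker_mul, Matrix.mul_one, projPlus_mul_projMinus,
      Matrix.kronecker_zero, map_zero]
  have hQP : Matrix.reindexAlgEquiv ℂ ℂ (Equiv.prodAssoc X Y (Fin 4))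
        ((1 : Matrix (X × Y) (X × Y) ℂ) ⊗ₖ ((1 / 2 : ℂ) • (1 - euclideanGamma 0))) *
      Matrix.reindexAlgEquiv ℂ ℂ (Equiv.prodAssoc X Y (Fin 4))
        ((1 : Matrix (X × Y) (X × Y) ℂ) ⊗ₖ ((1 / 2 : ℂ) • (1 + euclideanGamma 0))) = 0 := by
    rw [← map_mul, ← Matrix.mul_kronecker_mul, Matrix.mul_one, projMinus_mul_projPlus,
      Matrix.kronecker_zero, map_zero]
  have hPP := WilsonTransfer.mul_self_of_add_eq_one h1 hPQ
  have hW'W : Matrix.reindexAlgEquiv ℂ ℂ (Equiv.prodAssoc X Y (Fin 4))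
        (w' ⊗ₖ (1 : Matrix (Fin 4) (Fin 4) ℂ)) *
      Matrix.reindexAlgEquiv ℂ ℂ (Equiv.prodAssoc X Y (Fin 4))
        (w ⊗ₖ (1 : Matrix (Fin 4) (Fin 4) ℂ)) = 1 := by
    rw [← map_mul, ← Matrix.mul_kronecker_mul, hw, Matrix.mul_one, Matrix.one_kronecker_one,
      map_one]
  rw [ChainBlockDet.chainBlock_eq_mul h1 hPP hPQ hQP hA (kronecker_one_comm B _)
      (kronecker_one_comm w _) (kronecker_one_comm w' _) hW'W, Matrix.det_mul,
    ChainBlockDet.det_one_sub_eq_one hQP (kronecker_one_comm w _), mul_one,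
    ChainBlockDet.det_spinDiag_projMinus_sub_projPlus_colour B w', hw', one_pow, one_mul]

/-! ### Dictionary along `e`: `reindex e e (M ⊗ Γ)` as a transported Kronecker product -/

/-- `reindex e e (sliceKron M Γ)` (`e = (Equiv.prodAssoc flavour site (colour × spin)).symm`) is
the Kronecker product `reindex e′ e′ M ⊗ₖ Γ` transported along
`Equiv.prodAssoc (flavour × site) colour spin`, `e′ = (Equiv.prodAssoc flavour site colour).symm`.
[folklore] -/
theorem reindex_sliceKron_eq_kronecker (Nf L : ℕ) [NeZero L]
    (M : Matrix (SliceColourVar Nf L) (SliceColourVar Nf L) ℂ) (Γ : Matrix (Fin 4) (Fin 4) ℂ) :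
    Matrix.reindex (Equiv.prodAssoc (Fin Nf) (TorusSite 3 L) (Fin 3 × Fin 4)).symm
        (Equiv.prodAssoc (Fin Nf) (TorusSite 3 L) (Fin 3 × Fin 4)).symm (sliceKron M Γ) =
      Matrix.reindexAlgEquiv ℂ ℂ (Equiv.prodAssoc (Fin Nf × TorusSite 3 L) (Fin 3) (Fin 4))
        (Matrix.reindex (Equiv.prodAssoc (Fin Nf) (TorusSite 3 L) (Fin 3)).symm
            (Equiv.prodAssoc (Fin Nf) (TorusSite 3 L) (Fin 3)).symm M ⊗ₖ Γ) := by
  ext ⟨⟨f, y⟩, c, α⟩ ⟨⟨g, z⟩, d, β⟩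
  rfl

end StubFlavourChainDressedCore

/-- **E2 W2-3b: the `N_f`-flavour dressed core is Smit's `V M_F V⁻¹`, and the chain-block
prefactor.**  For an `SU(3)` gauge field `U` on `(ℤ/L)⁴`, masses `mq f > −1` and a time `t`, with
the explicit `Matrix.of` lifts of the γ0 projector chain on `(flavour × (ℤ/L)³) × colour × spin`
(`P± = ½(1 ± γ₄)`, `W′_s = ρ(U((s,y),0)⁻¹)`, the flavour-block-diagonal `r = 1` Wilson slice
operator `A`, `B̂ = reindex e e (A(U_t) ⊗ 1₄)`), `e = (Equiv.prodAssoc flavour site (colour × spin)).symm`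
and `U_t : e ↦ U((t, e.1), e.2.succ)`:
(1) `(1 + P⁺(A − B̂)P⁻)(B̂P⁺ + B̂⁻¹P⁻)(1 − P⁻(A − B̂)P⁺) = reindex e e ((1 ⊗ γ₄γ₅) M_F(U_t) (1 ⊗ γ₅γ₄))`;
(2) `(1 + P⁻(A − B̂)P⁺)(B̂⁻¹P⁺ + B̂P⁻)(1 − P⁺(A − B̂)P⁻) = reindex e e ((1 ⊗ γ₄γ₅) M_F(U_t)⁻¹ (1 ⊗ γ₅γ₄))`;
(3) `det (A P⁻ − P⁺ W′_{t−1}) = det (A(U_t))²`; (4) this determinant is a unit.  The statement is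
the registered stub signature verbatim.
[cite: Smit2023, §6.5 (6.91)] [cite: Luscher1977, pp. 283–292] -/
theorem stub_flavourChain_dressedCore :
    ∀ (Nf L : ℕ) [NeZero L] (U : GaugeConfig 4 L (Matrix.specialUnitaryGroup (Fin 3) ℂ)) (mq : Fin Nf → ℝ),
      (∀ f, -1 < mq f) → ∀ (t : ZMod L),
      let Pp : Matrix ((Fin Nf × TorusSite 3 L) × Fin 3 × Fin 4) ((Fin Nf × TorusSite 3 L) × Fin 3 × Fin 4) ℂ :=
        Matrix.of fun a b => if a.1 = b.1 ∧ a.2.1 = b.2.1 then ((1 / 2 : ℂ) • (1 + euclideanGamma 0)) a.2.2 b.2.2 else 0;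
      let Pm : Matrix ((Fin Nf × TorusSite 3 L) × Fin 3 × Fin 4) ((Fin Nf × TorusSite 3 L) × Fin 3 × Fin 4) ℂ :=
        Matrix.of fun a b => if a.1 = b.1 ∧ a.2.1 = b.2.1 then ((1 / 2 : ℂ) • (1 - euclideanGamma 0)) a.2.2 b.2.2 else 0;
      let W' : ZMod L → Matrix ((Fin Nf × TorusSite 3 L) × Fin 3 × Fin 4) ((Fin Nf × TorusSite 3 L) × Fin 3 × Fin 4) ℂ :=
        fun t => Matrix.of fun a b => if a.1 = b.1 ∧ a.2.2 = b.2.2 then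
          fundamentalRep (Fin 3) (U ((Fin.cons t a.1.2 : TorusSite 4 L), 0))⁻¹ a.2.1 b.2.1 else 0;
      let A : Matrix ((Fin Nf × TorusSite 3 L) × Fin 3 × Fin 4) ((Fin Nf × TorusSite 3 L) × Fin 3 × Fin 4) ℂ :=
        Matrix.of fun a b => if a.1.1 = b.1.1 then
          ((if a = b then ((mq a.1.1 + 4 * 1 : ℝ) : ℂ) else 0) -
            (1 / 2 : ℂ) * ∑ j : Fin 3,
              ((if b.1.2 = Literature.MathematicalPhysics.QuantumFieldTheory.Site.shift a.1.2 j then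
                  (((1 : ℝ) : ℂ) • (1 : Matrix (Fin 4) (Fin 4) ℂ) - euclideanGamma j.succ) a.2.2 b.2.2 *
                    fundamentalRep (Fin 3) (U ((Fin.cons t a.1.2 : TorusSite 4 L), j.succ)) a.2.1 b.2.1 else 0) +
                (if a.1.2 = Literature.MathematicalPhysics.QuantumFieldTheory.Site.shift b.1.2 j then
                  (((1 : ℝ) : ℂ) • (1 : Matrix (Fin 4) (Fin 4) ℂ) + euclideanGamma j.succ) a.2.2 b.2.2 *
                    fundamentalRep (Fin 3) (U ((Fin.cons t b.1.2 : TorusSite 4 L), j.succ))⁻¹ a.2.1 b.2.1 else 0)))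
          else 0;
      let Bh : Matrix ((Fin Nf × TorusSite 3 L) × Fin 3 × Fin 4) ((Fin Nf × TorusSite 3 L) × Fin 3 × Fin 4) ℂ :=
        Matrix.reindex (Equiv.prodAssoc (Fin Nf) (TorusSite 3 L) (Fin 3 × Fin 4)).symm
          (Equiv.prodAssoc (Fin Nf) (TorusSite 3 L) (Fin 3 × Fin 4)).symm
          (sliceKron (sliceMassHop (fun e : Edge 3 L => U ((Fin.cons t e.1 : TorusSite 4 L), e.2.succ)) mq) 1);
      (1 + Pp * (A - Bh) * Pm) * (Bh * Pp + Bh⁻¹ * Pm) * (1 - Pm * (A - Bh) * Pp) =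
        Matrix.reindex (Equiv.prodAssoc (Fin Nf) (TorusSite 3 L) (Fin 3 × Fin 4)).symm
          (Equiv.prodAssoc (Fin Nf) (TorusSite 3 L) (Fin 3 × Fin 4)).symm
          (sliceKron (Nf := Nf) 1 (euclideanGamma 0 * gammaFive) *
            fermionSliceMatrix (fun e : Edge 3 L => U ((Fin.cons t e.1 : TorusSite 4 L), e.2.succ)) mq *
            sliceKron 1 (gammaFive * euclideanGamma 0)) ∧
      (1 + Pm * (A - Bh) * Pp) * (Bh⁻¹ * Pp + Bh * Pm) * (1 - Pp * (A - Bh) * Pm) =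
        Matrix.reindex (Equiv.prodAssoc (Fin Nf) (TorusSite 3 L) (Fin 3 × Fin 4)).symm
          (Equiv.prodAssoc (Fin Nf) (TorusSite 3 L) (Fin 3 × Fin 4)).symm
          (sliceKron (Nf := Nf) 1 (euclideanGamma 0 * gammaFive) *
            (fermionSliceMatrix (fun e : Edge 3 L => U ((Fin.cons t e.1 : TorusSite 4 L), e.2.succ)) mq)⁻¹ *
            sliceKron 1 (gammaFive * euclideanGamma 0)) ∧
      (A * Pm - Pp * W' (t - 1)).det =
        (sliceMassHop (fun e : Edge 3 L => U ((Fin.cons t e.1 : TorusSite 4 L), e.2.succ)) mq).det ^ 2 ∧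
      IsUnit (A * Pm - Pp * W' (t - 1)).det := by
  intro Nf L _ U mq hm t Pp Pm W' A Bh
  -- the W2-3a dictionary facts (spin structure, invertibility of `B̂`)
  obtain ⟨-, -, -, -, hBP, hBQ, -, hQCQ, hBinv⟩ := stub_flavourChain_slice_dictionary Nf L U mq t
  obtain ⟨hBdet, -⟩ := hBinv hm
  -- the dictionary entries along `e`, in `let`-variable form
  have hPp : Pp = Matrix.reindex (Equiv.prodAssoc (Fin Nf) (TorusSite 3 L) (Fin 3 × Fin 4)).symm
      (Equiv.prodAssoc (Fin Nf) (TorusSite 3 L) (Fin 3 × Fin 4)).symm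
      (sliceKron (Nf := Nf) (S := L) 1 timeProjPlus) :=
    StubFlavourChainSliceDictionary.spinLift_eq_reindex Nf L timeProjPlus
  have hPm : Pm = Matrix.reindex (Equiv.prodAssoc (Fin Nf) (TorusSite 3 L) (Fin 3 × Fin 4)).symm
      (Equiv.prodAssoc (Fin Nf) (TorusSite 3 L) (Fin 3 × Fin 4)).symm
      (sliceKron (Nf := Nf) (S := L) 1 timeProjMinus) :=
    StubFlavourChainSliceDictionary.spinLift_eq_reindex Nf L timeProjMinus
  have hBh : Bh = Matrix.reindex (Equiv.prodAssoc (Fin Nf) (TorusSite 3 L) (Fin 3 × Fin 4)).symm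
      (Equiv.prodAssoc (Fin Nf) (TorusSite 3 L) (Fin 3 × Fin 4)).symm
      (sliceKron
        (sliceMassHop (fun e : Edge 3 L => U ((Fin.cons t e.1 : TorusSite 4 L), e.2.succ)) mq) 1) :=
    rfl
  have hAB : A - Bh = Matrix.reindex (Equiv.prodAssoc (Fin Nf) (TorusSite 3 L) (Fin 3 × Fin 4)).symm
      (Equiv.prodAssoc (Fin Nf) (TorusSite 3 L) (Fin 3 × Fin 4)).symm
      (sliceKron (Nf := Nf) (S := L) 1 (euclideanGamma 0) *
        sliceDiracKinetic (fun e : Edge 3 L => U ((Fin.cons t e.1 : TorusSite 4 L), e.2.succ))) :=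
    StubFlavourChainSliceDictionary.kineticRemainder_eq_reindex Nf L U mq t
  -- projection algebra on the flavoured slice index
  have h1 : Pp + Pm = 1 := liftProjPlus_add_liftProjMinus (Fin Nf × TorusSite 3 L) 3
  have hPQ : Pp * Pm = 0 := liftProjPlus_mul_liftProjMinus (Fin Nf × TorusSite 3 L) 3
  have hQP : Pm * Pp = 0 := liftProjMinus_mul_liftProjPlus (Fin Nf × TorusSite 3 L) 3
  have hPP : Pp * Pp = Pp := WilsonTransfer.mul_self_of_add_eq_one h1 hPQ
  have hQQ : Pm * Pm = Pm := WilsonTransfer.mul_self_of_add_eq_one ((add_comm Pm Pp).trans h1) hQP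
  -- (1) the dressed core is `reindex e e (V M_F V⁻¹)`
  have h1st : (1 + Pp * (A - Bh) * Pm) * (Bh * Pp + Bh⁻¹ * Pm) * (1 - Pm * (A - Bh) * Pp) =
      Matrix.reindex (Equiv.prodAssoc (Fin Nf) (TorusSite 3 L) (Fin 3 × Fin 4)).symm
        (Equiv.prodAssoc (Fin Nf) (TorusSite 3 L) (Fin 3 × Fin 4)).symm
        (sliceKron (Nf := Nf) 1 (euclideanGamma 0 * gammaFive) *
          fermionSliceMatrix (fun e : Edge 3 L => U ((Fin.cons t e.1 : TorusSite 4 L), e.2.succ))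
            mq *
          sliceKron 1 (gammaFive * euclideanGamma 0)) := by
    rw [hAB, hBh, hPp, hPm, Matrix.inv_reindex, ← DressedCoreDict.reindex_dressedCore,
      DressedCoreDict.dressedCore_sliceKron_eq]
  -- (2) the explicit inverse core is `reindex e e (V M_F⁻¹ V⁻¹)`
  have hBBi : Bh * Bh⁻¹ = 1 := Matrix.mul_nonsing_inv Bh hBdet
  have hBiB : Bh⁻¹ * Bh = 1 := Matrix.nonsing_inv_mul Bh hBdet
  have hcore : (1 + Pp * (A - Bh) * Pm) * (Bh * Pp + Bh⁻¹ * Pm) * (1 - Pm * (A - Bh) * Pp) *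
      ((1 + Pm * (A - Bh) * Pp) * (Bh⁻¹ * Pp + Bh * Pm) * (1 - Pp * (A - Bh) * Pm)) = 1 :=
    StubChainBlockInsertionAlgebra.core_mul_coreInv Pp Pm Bh Bh⁻¹ (A - Bh) h1 hPP hQQ hPQ hQP hBBi
      hBiB hBP hBQ
  have hVV' : sliceKron (Nf := Nf) (S := L) 1 (euclideanGamma 0 * gammaFive) *
      sliceKron 1 (gammaFive * euclideanGamma 0) = 1 :=
    SliceGammaConjugation.gamma05_sliceKron_mul_gamma50_sliceKron
  have hV'V : sliceKron (Nf := Nf) (S := L) 1 (gammaFive * euclideanGamma 0) *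
      sliceKron 1 (euclideanGamma 0 * gammaFive) = 1 :=
    mul_eq_one_comm.1 hVV'
  have h2nd : (1 + Pm * (A - Bh) * Pp) * (Bh⁻¹ * Pp + Bh * Pm) * (1 - Pp * (A - Bh) * Pm) =
      Matrix.reindex (Equiv.prodAssoc (Fin Nf) (TorusSite 3 L) (Fin 3 × Fin 4)).symm
        (Equiv.prodAssoc (Fin Nf) (TorusSite 3 L) (Fin 3 × Fin 4)).symm
        (sliceKron (Nf := Nf) 1 (euclideanGamma 0 * gammaFive) *
          (fermionSliceMatrix (fun e : Edge 3 L => U ((Fin.cons t e.1 : TorusSite 4 L), e.2.succ))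
            mq)⁻¹ *
          sliceKron 1 (gammaFive * euclideanGamma 0)) := by
    rw [← Matrix.inv_eq_right_inv hcore, h1st, Matrix.inv_reindex, Matrix.mul_inv_rev,
      Matrix.mul_inv_rev, Matrix.inv_eq_right_inv hV'V, Matrix.inv_eq_right_inv hVV',
      ← Matrix.mul_assoc]
  -- (3) the chain-block prefactor `det E_t = det A(U_t)²`, in Kronecker form on
  --     `((flavour × site) × colour) × spin`
  have hPpK : Pp =
      Matrix.reindexAlgEquiv ℂ ℂ (Equiv.prodAssoc (Fin Nf × TorusSite 3 L) (Fin 3) (Fin 4))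
      ((1 : Matrix ((Fin Nf × TorusSite 3 L) × Fin 3) ((Fin Nf × TorusSite 3 L) × Fin 3) ℂ) ⊗ₖ
        ((1 / 2 : ℂ) • (1 + euclideanGamma 0))) :=
    SliceSpin.of_spin_eq ((1 / 2 : ℂ) • (1 + euclideanGamma 0))
  have hPmK : Pm =
      Matrix.reindexAlgEquiv ℂ ℂ (Equiv.prodAssoc (Fin Nf × TorusSite 3 L) (Fin 3) (Fin 4))
      ((1 : Matrix ((Fin Nf × TorusSite 3 L) × Fin 3) ((Fin Nf × TorusSite 3 L) × Fin 3) ℂ) ⊗ₖ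
        ((1 / 2 : ℂ) • (1 - euclideanGamma 0))) :=
    SliceSpin.of_spin_eq ((1 / 2 : ℂ) • (1 - euclideanGamma 0))
  have hBhK : Bh =
      Matrix.reindexAlgEquiv ℂ ℂ (Equiv.prodAssoc (Fin Nf × TorusSite 3 L) (Fin 3) (Fin 4))
      (Matrix.reindex (Equiv.prodAssoc (Fin Nf) (TorusSite 3 L) (Fin 3)).symm
          (Equiv.prodAssoc (Fin Nf) (TorusSite 3 L) (Fin 3)).symm
          (sliceMassHop (fun e : Edge 3 L => U ((Fin.cons t e.1 : TorusSite 4 L), e.2.succ)) mq) ⊗ₖ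
        (1 : Matrix (Fin 4) (Fin 4) ℂ)) :=
    StubFlavourChainDressedCore.reindex_sliceKron_eq_kronecker Nf L _ 1
  have hW'K : W' (t - 1) =
      Matrix.reindexAlgEquiv ℂ ℂ (Equiv.prodAssoc (Fin Nf × TorusSite 3 L) (Fin 3) (Fin 4))
      ((Matrix.of fun p q : (Fin Nf × TorusSite 3 L) × Fin 3 =>
          if p.1 = q.1 then
            fundamentalRep (Fin 3) (U ((Fin.cons (t - 1) p.1.2 : TorusSite 4 L), 0))⁻¹ p.2 q.2
          else 0) ⊗ₖ
        (1 : Matrix (Fin 4) (Fin 4) ℂ)) :=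
    SliceSpin.of_colour_eq fun x : Fin Nf × TorusSite 3 L =>
      fundamentalRep (Fin 3) (U ((Fin.cons (t - 1) x.2 : TorusSite 4 L), 0))⁻¹
  have hA : Pm * A * Pm = Bh * Pm := by
    have e1 : Pm * A * Pm = Pm * (A - Bh) * Pm + Pm * Bh * Pm := by
      rw [Matrix.mul_sub, Matrix.sub_mul, sub_add_cancel]
    rw [e1, hQCQ, zero_add, ← hBQ, Matrix.mul_assoc, hQQ]
  rw [hPmK, hBhK] at hA
  have h3rd : (A * Pm - Pp * W' (t - 1)).det =
      (sliceMassHop (fun e : Edge 3 L => U ((Fin.cons t e.1 : TorusSite 4 L), e.2.succ)) mq).det ^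
        2 := by
    rw [hPmK, hPpK, hW'K, StubFlavourChainDressedCore.det_chainBlock_of_kronecker A _ _ _
        (StubFlavourChainDressedCore.invLinkBlock_mul_linkBlock fun x : Fin Nf × TorusSite 3 L =>
          U ((Fin.cons (t - 1) x.2 : TorusSite 4 L), 0))
        (StubFlavourChainDressedCore.det_invLinkBlock_eq_one fun x : Fin Nf × TorusSite 3 L =>
          U ((Fin.cons (t - 1) x.2 : TorusSite 4 L), 0)) hA,
      Matrix.det_reindex_self]
  -- (4) invertibility of the chain block for masses `> −1`
  have hdetA : IsUnit (sliceMassHop (Nf := Nf)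
      (fun e : Edge 3 L => U ((Fin.cons t e.1 : TorusSite 4 L), e.2.succ)) mq).det :=
    (Matrix.isUnit_iff_isUnit_det _).mp
      (sliceMassHop_posDef Nf L
        (fun e : Edge 3 L => U ((Fin.cons t e.1 : TorusSite 4 L), e.2.succ)) mq hm).isUnit
  have h4th : IsUnit (A * Pm - Pp * W' (t - 1)).det := by
    rw [h3rd]
    exact hdetA.pow 2
  exact ⟨h1st, h2nd, h3rd, h4th⟩

end Summit.QuantumFields.QCD.Cruxes.RobustYangMillsHandover.PinTheInfimum
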